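import Literature.Analysis.FluidPDE.KNSSMildDecayHorizontal
import Literature.Analysis.FluidPDE.OseenDuhamelPairCalculus
import HarnessLib

/-!
# The Duhamel term of bounded fields, one of which vanishes at spatial infinity, vanishes at
  spatial infinity — uniformly in time

Analysis/FluidPDE support file (everything proved; no definitions, no named facts).  Radial,
non-diagonal, any-dimension form of the qualitative decay statement of KNSS 2009 (proof of
Thm. 6.1, last paragraph: "Using the decay of the kernel (3.8) … all the terms in the
decomposition … will again satisfy (6.2)"), which the tree has in the horizontal (cylindrical)
diagonal form `exists_forall_norm_oseenDuhamel_le_of_cylRadius`.  For fields `p, q` bounded and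
jointly measurable, with `p` (resp. `q`) satisfying `sup_{τ ∈ (s,T), ‖y‖ ≥ R} ‖p(τ,y)‖ → 0` as
`R → ∞`, the Oseen–Duhamel term `B¹_s(p,q)(t)(x)` tends to `0` as `‖x‖ → ∞`, **uniformly in
`t ∈ [s, T]`** and with a threshold depending on the fields only through the bounds and the decay
modulus (so: uniformly over bounded, uniformly decaying families):

* `norm_oseenDuhamel_near_le_of_norm` — the Duhamel term of fields whose tensor product is
  supported in the ball `‖y‖ < R₀` is, at `‖x‖ ≥ R₀ + R₁` (`R₁ ≥ 1`), at most
  `C Mp Mq (t − s) ∫_{R₁ ≤ ‖z‖} 2^e (1 + ‖z‖²)^{−e} dz`, `e = (d+1)/2` (kernel decay (3.8));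
* `exists_forall_norm_oseenDuhamel_le_of_norm_left` — decay in the left slot,
* `exists_forall_norm_oseenDuhamel_le_of_norm_right` — decay in the right slot.

Proof: split the decaying field along `{‖y‖ ≥ R₀}` (bilinearity of the window calculus,
`oseenDuhamel_window_add_left/right`); the far piece is bounded by `η`, so its Duhamel term is
`O(η √(T − s))` everywhere (`norm_oseenDuhamel_le_const`); the near piece contributes the kernel
tail (`tendsto_setIntegral_norm_ge_atTop`).  This is the estimate by which sup-norm perturbation
theory of the Oseen equation around a Type-I profile stays in the class of fields vanishing at
infinity, and by which the Duhamel part of the linearised period map has uniformly small tails.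

## Mathlib / tree search

Tree: `exists_norm_oseenKernel_le`, `integrable_one_add_norm_sq_rpow_neg` (`KochTataruKernel.lean`),
`tendsto_setIntegral_norm_ge_atTop` (`KNSSMildDecayHorizontal.lean`), `norm_oseenDuhamel_le_const`,
`oseenDuhamel_window_add_left/right`, `oseenSliceConst(_pos)` (`OseenDuhamelPairCalculus.lean`),
`oseenKernel_zero_left/right`.  Mathlib: `lintegral_sub_left_eq_self`, `lintegral_indicator`,
`enorm_integral_le_lintegral_enorm`.

## References

* G. Koch, N. Nadirashvili, G. Seregin, V. Šverák, Acta Math. 203 (2009) = arXiv:0709.3599, §3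
  (3.8) and proof of Thm. 6.1, last paragraph (arXiv pp. 6, 12). [KochNadirashviliSereginSverak2009]
-/

noncomputable section

open MeasureTheory Set Function Filter
open _root_.Topology
open scoped ENNReal

namespace Literature.Analysis.FluidPDE

variable {E : Type*} [NormedAddCommGroup E] [InnerProductSpace ℝ E] [FiniteDimensional ℝ E]
  [MeasurableSpace E] [BorelSpace E]

/-- The dimension-dependent exponent `e = (d + 1)/2` of the kernel bound (3.8). -/
local notation "expo" E => ((Module.finrank ℝ E : ℝ) + 1) / 2

omit [InnerProductSpace ℝ E] [FiniteDimensional ℝ E] [MeasurableSpace E] [BorelSpace E] in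
/-- The parabolic weight off the unit ball is dominated by a fixed envelope: for `σ > 0`,
`‖z‖ ≥ 1` and `e ≥ 0`, `(σ + ‖z‖²)^{-e} ≤ 2^e (1 + ‖z‖²)^{-e}`. [folklore] -/
theorem rpow_neg_le_envelope [NormedSpace ℝ E] {σ e : ℝ} (hσ : 0 < σ) (he : 0 ≤ e) {z : E}
    (hz : 1 ≤ ‖z‖) :
    (σ + ‖z‖ ^ 2) ^ (-e) ≤ (2 : ℝ) ^ e * (1 + ‖z‖ ^ 2) ^ (-e) := by
  have hz2 : 1 ≤ ‖z‖ ^ 2 := by nlinarith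
  have h1 : (1 + ‖z‖ ^ 2) / 2 ≤ σ + ‖z‖ ^ 2 := by linarith
  have h2 : 0 < (1 + ‖z‖ ^ 2) / 2 := by positivity
  calc (σ + ‖z‖ ^ 2) ^ (-e) ≤ ((1 + ‖z‖ ^ 2) / 2) ^ (-e) :=
        Real.rpow_le_rpow_of_nonpos h2 h1 (by linarith)
    _ = (1 + ‖z‖ ^ 2) ^ (-e) / (2 : ℝ) ^ (-e) := Real.div_rpow (by positivity) (by norm_num) _
    _ = (2 : ℝ) ^ e * (1 + ‖z‖ ^ 2) ^ (-e) := by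
        rw [Real.rpow_neg (by norm_num : (0 : ℝ) ≤ 2), div_inv_eq_mul, mul_comm]

/-- **The Duhamel term of near fields is small far away** (kernel decay (3.8)). Let `v, w` be
fields on `(s, t)` bounded by `Mv, Mw` with `‖v(τ,y)‖ ‖w(τ,y)‖ = 0` whenever `‖y‖ ≥ R₀` (one of
them vanishes off the ball). Then at a point `x` with `‖x‖ ≥ R₀ + R₁`, `R₁ ≥ 1`,
`‖B¹_s(v,w)(t)(x)‖ ≤ C Mv Mw (t - s) ∫_{R₁ ≤ ‖z‖} 2^e (1 + ‖z‖²)^{-e} dz`, `e = (d+1)/2`, where `C`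
is the constant of `exists_norm_oseenKernel_le` (no measurability is needed for the upper
bound). [cite: KochNadirashviliSereginSverak2009, §3 (3.8) and proof of Thm 6.1, last paragraph (arXiv pp. 6, 12)] -/
theorem norm_oseenDuhamel_near_le_of_norm {C : ℝ} (hC : 0 < C)
    (hK : ∀ {τ : ℝ}, 0 < τ → ∀ z a b : E,
      ‖oseenKernel τ z a b‖ ≤ C * (τ + ‖z‖ ^ 2) ^ (-(expo E)) * ‖a‖ * ‖b‖)
    {v w : ℝ → E → E} {s t Mv Mw R₀ R₁ : ℝ} (hst : s < t) (hMv : 0 ≤ Mv) (hMw : 0 ≤ Mw)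
    (hv : ∀ τ ∈ Ioo s t, ∀ y, ‖v τ y‖ ≤ Mv) (hw : ∀ τ ∈ Ioo s t, ∀ y, ‖w τ y‖ ≤ Mw)
    (hsupp : ∀ τ ∈ Ioo s t, ∀ y, R₀ ≤ ‖y‖ → ‖v τ y‖ * ‖w τ y‖ = 0) (hR₁ : 1 ≤ R₁)
    {x : E} (hx : R₀ + R₁ ≤ ‖x‖) :
    ‖oseenDuhamel 1 s v w t x‖ ≤
      C * (Mv * Mw) * (t - s) * ∫ z in {z : E | R₁ ≤ ‖z‖},
        (2 : ℝ) ^ (expo E) * (1 + ‖z‖ ^ 2) ^ (-(expo E)) := by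
  have he0 : 0 ≤ expo E := by positivity
  set S : Set E := {z | R₁ ≤ ‖z‖} with hS
  have hSm : MeasurableSet S := (isClosed_le continuous_const continuous_norm).measurableSet
  set H : E → ℝ := fun z => (2 : ℝ) ^ (expo E) * (1 + ‖z‖ ^ 2) ^ (-(expo E)) with hH
  have hH0 : ∀ z, 0 ≤ H z := fun z => by positivity
  have hHi : Integrable H volume :=
    (integrable_one_add_norm_sq_rpow_neg (E := E) (e := expo E) (by linarith)).const_mul _
  set T : ℝ := ∫ z in S, H z with hT
  have hT0 : 0 ≤ T := setIntegral_nonneg hSm fun z _ => hH0 z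
  -- pointwise bound of the integrand by the translated envelope
  have hpt : ∀ τ ∈ Ioo s t, ∀ y,
      ‖oseenKernel (1 * (t - τ)) (x - y) (v τ y) (w τ y)‖ₑ ≤
        S.indicator (fun z => ENNReal.ofReal (C * (Mv * Mw) * H z)) (x - y) := by
    intro τ hτ y
    have hσ : 0 < 1 * (t - τ) := by rw [one_mul]; exact sub_pos.2 hτ.2
    by_cases hy : R₀ ≤ ‖y‖
    · have h0 := hsupp τ hτ y hy
      have : ‖oseenKernel (1 * (t - τ)) (x - y) (v τ y) (w τ y)‖ ≤ 0 := by
        calc _ ≤ C * (1 * (t - τ) + ‖x - y‖ ^ 2) ^ (-(expo E)) * ‖v τ y‖ * ‖w τ y‖ := hK hσ _ _ _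
          _ = C * (1 * (t - τ) + ‖x - y‖ ^ 2) ^ (-(expo E)) * (‖v τ y‖ * ‖w τ y‖) := by ring
          _ = 0 := by rw [h0, mul_zero]
      rw [show oseenKernel (1 * (t - τ)) (x - y) (v τ y) (w τ y) = 0 from
        norm_le_zero_iff.1 this, enorm_zero]
      exact zero_le
    · have hxy : R₁ ≤ ‖x - y‖ := by
        have h1 : ‖x‖ ≤ ‖x - y‖ + ‖y‖ := norm_le_norm_sub_add x y
        linarith [not_le.1 hy]
      rw [indicator_of_mem (show x - y ∈ S from hxy), ← ofReal_norm]
      refine ENNReal.ofReal_le_ofReal ?_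
      have henv := rpow_neg_le_envelope hσ he0 (hR₁.trans hxy)
      have hW0 : 0 ≤ C * ((2 : ℝ) ^ (expo E) * (1 + ‖x - y‖ ^ 2) ^ (-(expo E))) := by positivity
      have h1 : C * (1 * (t - τ) + ‖x - y‖ ^ 2) ^ (-(expo E)) ≤
          C * ((2 : ℝ) ^ (expo E) * (1 + ‖x - y‖ ^ 2) ^ (-(expo E))) :=
        mul_le_mul_of_nonneg_left henv hC.le
      have h2 : C * (1 * (t - τ) + ‖x - y‖ ^ 2) ^ (-(expo E)) * ‖v τ y‖ ≤
          C * ((2 : ℝ) ^ (expo E) * (1 + ‖x - y‖ ^ 2) ^ (-(expo E))) * Mv :=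
        mul_le_mul h1 (hv τ hτ y) (norm_nonneg _) hW0
      calc ‖oseenKernel (1 * (t - τ)) (x - y) (v τ y) (w τ y)‖
          ≤ C * (1 * (t - τ) + ‖x - y‖ ^ 2) ^ (-(expo E)) * ‖v τ y‖ * ‖w τ y‖ := hK hσ _ _ _
        _ ≤ C * ((2 : ℝ) ^ (expo E) * (1 + ‖x - y‖ ^ 2) ^ (-(expo E))) * Mv * Mw :=
            mul_le_mul h2 (hw τ hτ y) (norm_nonneg _) (mul_nonneg hW0 hMv)
        _ = C * (Mv * Mw) * H (x - y) := by rw [hH]; ring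
  -- integrate in `y`
  have hslice : ∀ τ ∈ Ioo s t,
      ∫⁻ y, ‖oseenKernel (1 * (t - τ)) (x - y) (v τ y) (w τ y)‖ₑ ≤
        ENNReal.ofReal (C * (Mv * Mw) * T) := by
    intro τ hτ
    calc ∫⁻ y, ‖oseenKernel (1 * (t - τ)) (x - y) (v τ y) (w τ y)‖ₑ
        ≤ ∫⁻ y, S.indicator (fun z => ENNReal.ofReal (C * (Mv * Mw) * H z)) (x - y) :=
          lintegral_mono fun y => hpt τ hτ y
      _ = ∫⁻ z, S.indicator (fun z => ENNReal.ofReal (C * (Mv * Mw) * H z)) z :=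
          lintegral_sub_left_eq_self
            (fun z => S.indicator (fun z => ENNReal.ofReal (C * (Mv * Mw) * H z)) z) x
      _ = ∫⁻ z in S, ENNReal.ofReal (C * (Mv * Mw) * H z) := lintegral_indicator hSm _
      _ = ENNReal.ofReal (∫ z in S, C * (Mv * Mw) * H z) := by
          rw [ofReal_integral_eq_lintegral_ofReal ((hHi.const_mul _).integrableOn)
            (Eventually.of_forall fun z => by positivity)]
      _ = ENNReal.ofReal (C * (Mv * Mw) * T) := by rw [integral_const_mul]
  -- integrate in `τ`
  have hmain : ‖oseenDuhamel 1 s v w t x‖ₑ ≤ ENNReal.ofReal (C * (Mv * Mw) * T * (t - s)) := by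
    calc ‖oseenDuhamel 1 s v w t x‖ₑ
        ≤ ∫⁻ τ in Ioo s t, ‖∫ y, oseenKernel (1 * (t - τ)) (x - y) (v τ y) (w τ y)‖ₑ := by
          rw [oseenDuhamel_apply]; exact enorm_integral_le_lintegral_enorm _
      _ ≤ ∫⁻ τ in Ioo s t, ∫⁻ y, ‖oseenKernel (1 * (t - τ)) (x - y) (v τ y) (w τ y)‖ₑ :=
          lintegral_mono fun τ => enorm_integral_le_lintegral_enorm _
      _ ≤ ∫⁻ τ in Ioo s t, ENNReal.ofReal (C * (Mv * Mw) * T) :=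
          setLIntegral_mono' measurableSet_Ioo hslice
      _ = ENNReal.ofReal (C * (Mv * Mw) * T) * volume (Ioo s t) := setLIntegral_const _ _
      _ = ENNReal.ofReal (C * (Mv * Mw) * T * (t - s)) := by
          rw [Real.volume_Ioo, ← ENNReal.ofReal_mul (by positivity)]
  rw [← ofReal_norm] at hmain
  have h := (ENNReal.ofReal_le_ofReal_iff (by have := sub_pos.2 hst; positivity)).1 hmain
  calc ‖oseenDuhamel 1 s v w t x‖ ≤ C * (Mv * Mw) * T * (t - s) := h
    _ = C * (Mv * Mw) * (t - s) * T := by ring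

/-- **The Duhamel term of bounded fields, the LEFT one vanishing at spatial infinity uniformly in
time, vanishes at spatial infinity uniformly in time.**  For `p, q` jointly measurable on `ℝ × E`
and bounded by `Mp, Mq` on `(s, T) × E`, with `∀ η > 0, ∃ R, ∀ τ ∈ (s,T), ‖y‖ ≥ R → ‖p(τ,y)‖ ≤ η`,
and every `ε > 0`, there is `A` such that `‖B¹_s(p,q)(t)(x)‖ ≤ ε` for all `t ∈ [s, T]` and all
`‖x‖ ≥ A`.  The threshold depends on the fields only through `Mp, Mq` and the decay modulus.
(KNSS 2009, proof of Thm. 6.1, last paragraph, qualitatively.) [cite: KochNadirashviliSereginSverak2009, proof of Thm 6.1, last paragraph (arXiv p. 12)] -/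
theorem exists_forall_norm_oseenDuhamel_le_of_norm_left {p q : ℝ → E → E} {s T Mp Mq : ℝ}
    (hpm : Measurable (uncurry p)) (hqm : Measurable (uncurry q)) (hMp : 0 ≤ Mp) (hMq : 0 ≤ Mq)
    (hp : ∀ τ ∈ Ioo s T, ∀ y, ‖p τ y‖ ≤ Mp) (hq : ∀ τ ∈ Ioo s T, ∀ y, ‖q τ y‖ ≤ Mq)
    (hdec : ∀ η : ℝ, 0 < η → ∃ R : ℝ, ∀ τ ∈ Ioo s T, ∀ y, R ≤ ‖y‖ → ‖p τ y‖ ≤ η)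
    {ε : ℝ} (hε : 0 < ε) :
    ∃ A : ℝ, ∀ t ∈ Icc s T, ∀ x, A ≤ ‖x‖ → ‖oseenDuhamel 1 s p q t x‖ ≤ ε := by
  obtain ⟨C, hC, hK⟩ := exists_norm_oseenKernel_le (E := E)
  have hC₀ := oseenSliceConst_pos (E := E)
  -- the far threshold: `C₀ η Mq 2√(T-s) ≤ ε/2`
  set Λ : ℝ := oseenSliceConst E * Mq * (2 * Real.sqrt (T - s)) with hΛ
  have hΛ0 : 0 ≤ Λ := by positivity
  set η : ℝ := ε / 2 / (Λ + 1) with hη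
  have hη0 : 0 < η := by positivity
  have hΛη : Λ * η ≤ ε / 2 := by
    rw [hη]
    calc Λ * (ε / 2 / (Λ + 1)) = ε / 2 * (Λ / (Λ + 1)) := by ring
      _ ≤ ε / 2 * 1 := by gcongr; rw [div_le_one (by positivity)]; linarith
      _ = ε / 2 := mul_one _
  obtain ⟨R₀, hR₀⟩ := hdec η hη0
  -- the near threshold: the kernel tail
  set H : E → ℝ := fun z => (2 : ℝ) ^ (expo E) * (1 + ‖z‖ ^ 2) ^ (-(expo E)) with hH
  have hHi : Integrable H volume :=
    (integrable_one_add_norm_sq_rpow_neg (E := E) (e := expo E) (by linarith)).const_mul _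
  have htail := tendsto_setIntegral_norm_ge_atTop hHi
  -- if `T < s` the family of times is empty
  rcases lt_or_ge T s with hTs | hsT
  · exact ⟨0, fun t ht _ _ => absurd (ht.1.trans ht.2) (not_le.2 hTs)⟩
  have hTs0 : 0 ≤ T - s := sub_nonneg.2 hsT
  set θ : ℝ := ε / 2 / (C * (Mp * Mq) * (T - s) + 1) with hθ
  have hden : 0 < C * (Mp * Mq) * (T - s) + 1 := by positivity
  have hθ0 : 0 < θ := by positivity
  obtain ⟨R₁, hR₁⟩ :=
    ((htail.eventually (gt_mem_nhds hθ0)).and (eventually_ge_atTop 1)).exists_forall_of_atTop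
  refine ⟨R₀ + R₁, fun t ht x hx => ?_⟩
  rcases ht.1.eq_or_lt with h | hst
  · -- `t = s`: the Duhamel term vanishes
    rw [← h, oseenDuhamel_eq_zero_of_le le_rfl, norm_zero]; exact hε.le
  -- split the left field along `{R₀ ≤ ‖y‖}`
  set O : Set E := {y | R₀ ≤ ‖y‖} with hO
  have hOm : MeasurableSet O := (isClosed_le continuous_const continuous_norm).measurableSet
  set pf : ℝ → E → E := fun τ y => O.indicator (p τ) y with hpf
  set pn : ℝ → E → E := fun τ y => Oᶜ.indicator (p τ) y with hpn
  have hpfm : Measurable (uncurry pf) := by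
    have : uncurry pf = ((univ : Set ℝ) ×ˢ O).indicator (uncurry p) := by
      funext z; obtain ⟨τ, y⟩ := z
      simp only [uncurry, hpf, Set.indicator_apply, Set.mem_prod, Set.mem_univ, true_and]
    rw [this]; exact hpm.indicator (MeasurableSet.univ.prod hOm)
  have hpnm : Measurable (uncurry pn) := by
    have : uncurry pn = ((univ : Set ℝ) ×ˢ Oᶜ).indicator (uncurry p) := by
      funext z; obtain ⟨τ, y⟩ := z
      simp only [uncurry, hpn, Set.indicator_apply, Set.mem_prod, Set.mem_univ, true_and]
    rw [this]; exact hpm.indicator (MeasurableSet.univ.prod hOm.compl)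
  have hsum : p = pf + pn := by
    funext τ y
    simp only [hpf, hpn, Pi.add_apply]
    exact (Set.indicator_self_add_compl_apply O (p τ) y).symm
  have hpt : ∀ τ ∈ Ioo s t, τ ∈ Ioo s T := fun τ hτ => ⟨hτ.1, hτ.2.trans_le ht.2⟩
  have hbf : ∀ τ ∈ Ioo s t, ∀ y, ‖pf τ y‖ ≤ η := by
    intro τ hτ y
    simp only [hpf]
    by_cases hy : y ∈ O
    · rw [indicator_of_mem hy]; exact hR₀ τ (hpt τ hτ) y hy
    · rw [indicator_of_notMem hy, norm_zero]; exact hη0.le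
  have hbn : ∀ τ ∈ Ioo s t, ∀ y, ‖pn τ y‖ ≤ Mp := by
    intro τ hτ y
    simp only [hpn]
    by_cases hy : y ∈ Oᶜ
    · rw [indicator_of_mem hy]; exact hp τ (hpt τ hτ) y
    · rw [indicator_of_notMem hy, norm_zero]; exact hMp
  have hq' : ∀ τ ∈ Ioo s t, ∀ y, ‖q τ y‖ ≤ Mq := fun τ hτ y => hq τ (hpt τ hτ) y
  have hsplit : oseenDuhamel 1 s p q t x = oseenDuhamel 1 s pf q t x + oseenDuhamel 1 s pn q t x := by
    conv_lhs => rw [hsum]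
    exact oseenDuhamel_window_add_left hpfm hpnm hqm hbf hbn hq' x
  -- the far part
  have hfar : ‖oseenDuhamel 1 s pf q t x‖ ≤ ε / 2 := by
    have h := norm_oseenDuhamel_le_const hst.le hbf hq' x
    calc _ ≤ oseenSliceConst E * (η * Mq) * (2 * Real.sqrt (t - s)) := h
      _ ≤ oseenSliceConst E * (η * Mq) * (2 * Real.sqrt (T - s)) := by
          gcongr; exact ht.2
      _ = Λ * η := by rw [hΛ]; ring
      _ ≤ ε / 2 := hΛη
  -- the near part
  have hnear : ‖oseenDuhamel 1 s pn q t x‖ ≤ ε / 2 := by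
    have hsupp : ∀ τ ∈ Ioo s t, ∀ y, R₀ ≤ ‖y‖ → ‖pn τ y‖ * ‖q τ y‖ = 0 := by
      intro τ _ y hy
      have hyO : y ∉ Oᶜ := fun h => h hy
      simp only [hpn, indicator_of_notMem hyO, norm_zero, zero_mul]
    have h := norm_oseenDuhamel_near_le_of_norm hC hK hst hMp hMq hbn hq' hsupp (hR₁ R₁ le_rfl).2 hx
    have hT : ∫ z in {z : E | R₁ ≤ ‖z‖}, H z < θ := (hR₁ R₁ le_rfl).1
    have hc0 : 0 ≤ C * (Mp * Mq) * (t - s) := by have := sub_pos.2 hst; positivity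
    have hts : C * (Mp * Mq) * (t - s) ≤ C * (Mp * Mq) * (T - s) := by gcongr; exact ht.2
    calc _ ≤ C * (Mp * Mq) * (t - s) * ∫ z in {z : E | R₁ ≤ ‖z‖}, H z := h
      _ ≤ C * (Mp * Mq) * (t - s) * θ := mul_le_mul_of_nonneg_left hT.le hc0
      _ ≤ C * (Mp * Mq) * (T - s) * θ := mul_le_mul_of_nonneg_right hts hθ0.le
      _ = ε / 2 * (C * (Mp * Mq) * (T - s) / (C * (Mp * Mq) * (T - s) + 1)) := by rw [hθ]; ring
      _ ≤ ε / 2 * 1 := by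
          gcongr
          rw [div_le_one hden]; linarith
      _ = ε / 2 := mul_one _
  rw [hsplit]
  calc _ ≤ ‖oseenDuhamel 1 s pf q t x‖ + ‖oseenDuhamel 1 s pn q t x‖ := norm_add_le _ _
    _ ≤ ε / 2 + ε / 2 := add_le_add hfar hnear
    _ = ε := by ring

/-- **The Duhamel term of bounded fields, the RIGHT one vanishing at spatial infinity uniformly in
time, vanishes at spatial infinity uniformly in time** (twin of
`exists_forall_norm_oseenDuhamel_le_of_norm_left`, splitting the right slot). [cite: KochNadirashviliSereginSverak2009, proof of Thm 6.1, last paragraph (arXiv p. 12)] -/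
theorem exists_forall_norm_oseenDuhamel_le_of_norm_right {p q : ℝ → E → E} {s T Mp Mq : ℝ}
    (hpm : Measurable (uncurry p)) (hqm : Measurable (uncurry q)) (hMp : 0 ≤ Mp) (hMq : 0 ≤ Mq)
    (hp : ∀ τ ∈ Ioo s T, ∀ y, ‖p τ y‖ ≤ Mp) (hq : ∀ τ ∈ Ioo s T, ∀ y, ‖q τ y‖ ≤ Mq)
    (hdec : ∀ η : ℝ, 0 < η → ∃ R : ℝ, ∀ τ ∈ Ioo s T, ∀ y, R ≤ ‖y‖ → ‖q τ y‖ ≤ η)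
    {ε : ℝ} (hε : 0 < ε) :
    ∃ A : ℝ, ∀ t ∈ Icc s T, ∀ x, A ≤ ‖x‖ → ‖oseenDuhamel 1 s p q t x‖ ≤ ε := by
  obtain ⟨C, hC, hK⟩ := exists_norm_oseenKernel_le (E := E)
  have hC₀ := oseenSliceConst_pos (E := E)
  set Λ : ℝ := oseenSliceConst E * Mp * (2 * Real.sqrt (T - s)) with hΛ
  have hΛ0 : 0 ≤ Λ := by positivity
  set η : ℝ := ε / 2 / (Λ + 1) with hη
  have hη0 : 0 < η := by positivity
  have hΛη : Λ * η ≤ ε / 2 := by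
    rw [hη]
    calc Λ * (ε / 2 / (Λ + 1)) = ε / 2 * (Λ / (Λ + 1)) := by ring
      _ ≤ ε / 2 * 1 := by gcongr; rw [div_le_one (by positivity)]; linarith
      _ = ε / 2 := mul_one _
  obtain ⟨R₀, hR₀⟩ := hdec η hη0
  set H : E → ℝ := fun z => (2 : ℝ) ^ (expo E) * (1 + ‖z‖ ^ 2) ^ (-(expo E)) with hH
  have hHi : Integrable H volume :=
    (integrable_one_add_norm_sq_rpow_neg (E := E) (e := expo E) (by linarith)).const_mul _
  have htail := tendsto_setIntegral_norm_ge_atTop hHi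
  -- if `T < s` the family of times is empty
  rcases lt_or_ge T s with hTs | hsT
  · exact ⟨0, fun t ht _ _ => absurd (ht.1.trans ht.2) (not_le.2 hTs)⟩
  have hTs0 : 0 ≤ T - s := sub_nonneg.2 hsT
  set θ : ℝ := ε / 2 / (C * (Mp * Mq) * (T - s) + 1) with hθ
  have hden : 0 < C * (Mp * Mq) * (T - s) + 1 := by positivity
  have hθ0 : 0 < θ := by positivity
  obtain ⟨R₁, hR₁⟩ :=
    ((htail.eventually (gt_mem_nhds hθ0)).and (eventually_ge_atTop 1)).exists_forall_of_atTop
  refine ⟨R₀ + R₁, fun t ht x hx => ?_⟩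
  rcases ht.1.eq_or_lt with h | hst
  · rw [← h, oseenDuhamel_eq_zero_of_le le_rfl, norm_zero]; exact hε.le
  set O : Set E := {y | R₀ ≤ ‖y‖} with hO
  have hOm : MeasurableSet O := (isClosed_le continuous_const continuous_norm).measurableSet
  set qf : ℝ → E → E := fun τ y => O.indicator (q τ) y with hqf
  set qn : ℝ → E → E := fun τ y => Oᶜ.indicator (q τ) y with hqn
  have hqfm : Measurable (uncurry qf) := by
    have : uncurry qf = ((univ : Set ℝ) ×ˢ O).indicator (uncurry q) := by
      funext z; obtain ⟨τ, y⟩ := z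
      simp only [uncurry, hqf, Set.indicator_apply, Set.mem_prod, Set.mem_univ, true_and]
    rw [this]; exact hqm.indicator (MeasurableSet.univ.prod hOm)
  have hqnm : Measurable (uncurry qn) := by
    have : uncurry qn = ((univ : Set ℝ) ×ˢ Oᶜ).indicator (uncurry q) := by
      funext z; obtain ⟨τ, y⟩ := z
      simp only [uncurry, hqn, Set.indicator_apply, Set.mem_prod, Set.mem_univ, true_and]
    rw [this]; exact hqm.indicator (MeasurableSet.univ.prod hOm.compl)
  have hsum : q = qf + qn := by
    funext τ y
    simp only [hqf, hqn, Pi.add_apply]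
    exact (Set.indicator_self_add_compl_apply O (q τ) y).symm
  have hpt : ∀ τ ∈ Ioo s t, τ ∈ Ioo s T := fun τ hτ => ⟨hτ.1, hτ.2.trans_le ht.2⟩
  have hbf : ∀ τ ∈ Ioo s t, ∀ y, ‖qf τ y‖ ≤ η := by
    intro τ hτ y
    simp only [hqf]
    by_cases hy : y ∈ O
    · rw [indicator_of_mem hy]; exact hR₀ τ (hpt τ hτ) y hy
    · rw [indicator_of_notMem hy, norm_zero]; exact hη0.le
  have hbn : ∀ τ ∈ Ioo s t, ∀ y, ‖qn τ y‖ ≤ Mq := by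
    intro τ hτ y
    simp only [hqn]
    by_cases hy : y ∈ Oᶜ
    · rw [indicator_of_mem hy]; exact hq τ (hpt τ hτ) y
    · rw [indicator_of_notMem hy, norm_zero]; exact hMq
  have hp' : ∀ τ ∈ Ioo s t, ∀ y, ‖p τ y‖ ≤ Mp := fun τ hτ y => hp τ (hpt τ hτ) y
  have hsplit : oseenDuhamel 1 s p q t x = oseenDuhamel 1 s p qf t x + oseenDuhamel 1 s p qn t x := by
    conv_lhs => rw [hsum]
    exact oseenDuhamel_window_add_right hpm hqfm hqnm hp' hbf hbn x
  have hfar : ‖oseenDuhamel 1 s p qf t x‖ ≤ ε / 2 := by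
    have h := norm_oseenDuhamel_le_const hst.le hp' hbf x
    calc _ ≤ oseenSliceConst E * (Mp * η) * (2 * Real.sqrt (t - s)) := h
      _ ≤ oseenSliceConst E * (Mp * η) * (2 * Real.sqrt (T - s)) := by
          gcongr; exact ht.2
      _ = Λ * η := by rw [hΛ]; ring
      _ ≤ ε / 2 := hΛη
  have hnear : ‖oseenDuhamel 1 s p qn t x‖ ≤ ε / 2 := by
    have hsupp : ∀ τ ∈ Ioo s t, ∀ y, R₀ ≤ ‖y‖ → ‖p τ y‖ * ‖qn τ y‖ = 0 := by
      intro τ _ y hy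
      have hyO : y ∉ Oᶜ := fun h => h hy
      simp only [hqn, indicator_of_notMem hyO, norm_zero, mul_zero]
    have h := norm_oseenDuhamel_near_le_of_norm hC hK hst hMp hMq hp' hbn hsupp (hR₁ R₁ le_rfl).2 hx
    have hT : ∫ z in {z : E | R₁ ≤ ‖z‖}, H z < θ := (hR₁ R₁ le_rfl).1
    have hc0 : 0 ≤ C * (Mp * Mq) * (t - s) := by have := sub_pos.2 hst; positivity
    have hts : C * (Mp * Mq) * (t - s) ≤ C * (Mp * Mq) * (T - s) := by gcongr; exact ht.2
    calc _ ≤ C * (Mp * Mq) * (t - s) * ∫ z in {z : E | R₁ ≤ ‖z‖}, H z := h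
      _ ≤ C * (Mp * Mq) * (t - s) * θ := mul_le_mul_of_nonneg_left hT.le hc0
      _ ≤ C * (Mp * Mq) * (T - s) * θ := mul_le_mul_of_nonneg_right hts hθ0.le
      _ = ε / 2 * (C * (Mp * Mq) * (T - s) / (C * (Mp * Mq) * (T - s) + 1)) := by rw [hθ]; ring
      _ ≤ ε / 2 * 1 := by
          gcongr
          rw [div_le_one hden]; linarith
      _ = ε / 2 := mul_one _
  rw [hsplit]
  calc _ ≤ ‖oseenDuhamel 1 s p qf t x‖ + ‖oseenDuhamel 1 s p qn t x‖ := norm_add_le _ _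
    _ ≤ ε / 2 + ε / 2 := add_le_add hfar hnear
    _ = ε := by ring

end Literature.Analysis.FluidPDE

end
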